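import Mathlib
import Summits.QuantumAdvantage.QuantumAdvantage.Theorems.MobiusLadderQuadraticDigitPhasesStubBlockSum

/-!
# `QuadraticDigitPhases` (stmt-QuantumAdvantage-1391), line `Sketch` — stub `stub_opSem`

OPERATOR SEMANTICS of the reduced carry automaton (pure bookkeeping).  Fix multipliers `p, q ≥ 1`
and a polynomial `P` in the binary digits `x₀, …, x_{n-1}` over `ZMod 2`.  At level `M` a residue
`T < 2^M` has the reduced state `σ_M(T) = (⌊pT/2^M⌋, ⌊qT/2^M⌋, πᵖ_M(T), π^q_M(T))` (two carries and
two pending linear forms `π_M(T) j = Σ_{i<M} a_{ij} yᵢ`, `j ≥ M`, in the digits `yᵢ` of `pT`, resp.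
`qT`) and the sign `(-1)^{Φ_M(T)}`, `Φ_M` = pairs `i<j<M` plus linear terms `i<M` of `P` on both
sides; `fib M x π π'` is the sum of the signs over the fibre `σ_M⁻¹(x, π, π')`.

* `stub_opSem`, INIT: at `M = 0` the only residue is `T = 0`, with state `((0,0),0,0)` and sign `+1`.
* `stub_opSem`, STEP: write `T' = t·2^N + T` (`t ∈ {0,1}`, `T < 2^N`; `sum_range_double`).  Then
  (`testBit_mul_block` of the block-sum file) the digits of `pT'` below `N` are those of `pT`, the
  digit at `N` is `(p t + ⌊pT/2^N⌋) mod 2` (`bit_succ`) and `⌊pT'/2^{N+1}⌋ = (p t + ⌊pT/2^N⌋)/2`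
  (`carry_succ`); hence the new pending forms (`pend_succ`) and the new phase
  `Φ_{N+1}(T') = Φ_N(T) + y_N (π_N(T) N + ℓ_N)` (`phase_succ`, `sign_succ`: signs are multiplicative,
  `sign_add`) are functions of `(σ_N(T), t)` only — the transition and the step sign of the
  statement.  `transfer` is the abstract regrouping of `Σ_{T'}` as `Σ_t Σ_{states} Σ_{fibre}`
  (`sum_fiber_regroup`, via `Finset.sum_fiberwise_of_maps_to`; the carries are `< p`, `< q`).
-/

set_option linter.dupNamespace false -- D-0017: single-problem summit ⇒ `QuantumAdvantage.QuantumAdvantage` by design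

namespace Summit.QuantumAdvantage.QuantumAdvantage.Theorems.MobiusLadderQuadraticDigitPhasesStubOpSem

open Finset
open Summit.QuantumAdvantage.QuantumAdvantage.Theorems.MobiusLadderQuadraticDigitPhasesStubOneCutKatai
  (sign_add)
open Summit.QuantumAdvantage.QuantumAdvantage.Theorems.MobiusLadderQuadraticDigitPhasesStubBlockSum
  (testBit_mul_block)

/-- REGROUPING ALONG FIBRES: if the weight `c` depends on `i` only through `(a i, b i, u i, v i)` and
`(a i, b i) ∈ A` on `s`, then `Σ_{i∈s} c(σ i) sgn i = Σ_{x∈A} Σ_y Σ_z c(x,y,z) Σ_{i ∈ s, σ i = (x,y,z)} sgn i`. -/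
theorem sum_fiber_regroup {ι α β γ δ : Type*} [DecidableEq α] [DecidableEq β] [Fintype γ]
    [DecidableEq γ] [Fintype δ] [DecidableEq δ] (s : Finset ι) (A : Finset (α × β)) (a : ι → α)
    (b : ι → β) (u : ι → γ) (v : ι → δ) (hab : ∀ i ∈ s, (a i, b i) ∈ A) (sgn : ι → ℝ)
    (c : α × β → γ → δ → ℝ) :
    ∑ i ∈ s, c (a i, b i) (u i) (v i) * sgn i = ∑ x ∈ A, ∑ y : γ, ∑ z : δ,
      c x y z * ∑ i ∈ s.filter (fun i => a i = x.1 ∧ b i = x.2 ∧ u i = y ∧ v i = z), sgn i := by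
  have hmaps : ∀ i ∈ s, ((a i, b i), (u i, v i)) ∈
      A ×ˢ ((Finset.univ : Finset γ) ×ˢ (Finset.univ : Finset δ)) := fun i hi =>
    Finset.mem_product.mpr ⟨hab i hi, Finset.mem_product.mpr ⟨Finset.mem_univ _, Finset.mem_univ _⟩⟩
  rw [← Finset.sum_fiberwise_of_maps_to hmaps (f := fun i => c (a i, b i) (u i) (v i) * sgn i),
    Finset.sum_product]
  refine Finset.sum_congr rfl fun x _ => ?_
  rw [Finset.sum_product]
  refine Finset.sum_congr rfl fun y _ => Finset.sum_congr rfl fun z _ => ?_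
  have hfilter : s.filter (fun i => ((a i, b i), (u i, v i)) = (x, (y, z))) =
      s.filter (fun i => a i = x.1 ∧ b i = x.2 ∧ u i = y ∧ v i = z) :=
    Finset.filter_congr fun i _ => by simp only [Prod.ext_iff, and_assoc]
  rw [hfilter, Finset.mul_sum]
  refine Finset.sum_congr rfl fun i hi => ?_
  obtain ⟨_, h1, h2, h3, h4⟩ := Finset.mem_filter.mp hi
  rw [h1, h2, h3, h4, Prod.mk.eta]

/-- ONE SHEET of the transfer (a fixed top digit, embedded by `e`): if the new state and the new sign of
`e i` are functions (`ta, tb, tu, tv`, `st · sgn i`) of the old state of `i`, the new fibre sum over the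
sheet is the transition-weighted sum of the old fibre sums. -/
theorem transfer_t {ι α β γ δ : Type*} [DecidableEq α] [DecidableEq β] [Fintype γ] [DecidableEq γ]
    [Fintype δ] [DecidableEq δ] (s : Finset ι) (A : Finset (α × β)) (a : ι → α) (b : ι → β)
    (u : ι → γ) (v : ι → δ) (sgn : ι → ℝ) (hab : ∀ i ∈ s, (a i, b i) ∈ A) (e : ι → ι)
    (a' : ι → α) (b' : ι → β) (u' : ι → γ) (v' : ι → δ) (sgn' : ι → ℝ)
    (ta : α × β → γ → δ → α) (tb : α × β → γ → δ → β) (tu : α × β → γ → δ → γ)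
    (tv : α × β → γ → δ → δ) (st : α × β → γ → δ → ℝ)
    (hstep : ∀ i, a' (e i) = ta (a i, b i) (u i) (v i) ∧ b' (e i) = tb (a i, b i) (u i) (v i) ∧
      u' (e i) = tu (a i, b i) (u i) (v i) ∧ v' (e i) = tv (a i, b i) (u i) (v i) ∧
      sgn' (e i) = st (a i, b i) (u i) (v i) * sgn i)
    (x' : α × β) (y' : γ) (z' : δ) :
    ∑ i ∈ s, (if a' (e i) = x'.1 ∧ b' (e i) = x'.2 ∧ u' (e i) = y' ∧ v' (e i) = z'
      then sgn' (e i) else 0) =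
    ∑ x ∈ A, ∑ y : γ, ∑ z : δ, if ta x y z = x'.1 ∧ tb x y z = x'.2 ∧ tu x y z = y' ∧ tv x y z = z'
      then st x y z * ∑ i ∈ s.filter (fun i => a i = x.1 ∧ b i = x.2 ∧ u i = y ∧ v i = z), sgn i
      else 0 := by
  obtain ⟨c, hc⟩ : ∃ c : α × β → γ → δ → ℝ, ∀ x y z, c x y z =
      if ta x y z = x'.1 ∧ tb x y z = x'.2 ∧ tu x y z = y' ∧ tv x y z = z' then st x y z else 0 :=
    ⟨_, fun _ _ _ => rfl⟩
  have h1 : ∀ i ∈ s, (if a' (e i) = x'.1 ∧ b' (e i) = x'.2 ∧ u' (e i) = y' ∧ v' (e i) = z'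
      then sgn' (e i) else 0) = c (a i, b i) (u i) (v i) * sgn i := by
    intro i _
    obtain ⟨h1, h2, h3, h4, h5⟩ := hstep i
    rw [h1, h2, h3, h4, h5, hc, ite_mul, zero_mul]
  rw [Finset.sum_congr rfl h1, sum_fiber_regroup s A a b u v hab sgn c]
  simp only [hc, ite_mul, zero_mul]

/-- ABSTRACT TRANSFER RECURSION: `s'` is covered by the two sheets `e 0 '' s`, `e 1 '' s` (`hs'`), on each
sheet the new state/sign is a function of the old state (`hstep`); then the new fibre sums are given by
the one-step recursion with `t ∈ range 2`. -/
theorem transfer {ι α β γ δ : Type*} [DecidableEq α] [DecidableEq β] [Fintype γ] [DecidableEq γ]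
    [Fintype δ] [DecidableEq δ] (s' s : Finset ι) (A : Finset (α × β)) (e : ℕ → ι → ι)
    {a : ι → α} {b : ι → β} {u : ι → γ} {v : ι → δ} {sgn : ι → ℝ}
    {a' : ι → α} {b' : ι → β} {u' : ι → γ} {v' : ι → δ} {sgn' : ι → ℝ}
    {ta : ℕ → α × β → γ → δ → α} {tb : ℕ → α × β → γ → δ → β} {tu : ℕ → α × β → γ → δ → γ}
    {tv : ℕ → α × β → γ → δ → δ} {st : ℕ → α × β → γ → δ → ℝ} {fibN : α × β → γ → δ → ℝ}
    (hfibN : ∀ x y z, fibN x y z =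
      ∑ i ∈ s.filter (fun i => a i = x.1 ∧ b i = x.2 ∧ u i = y ∧ v i = z), sgn i)
    (hs' : ∀ g : ι → ℝ, ∑ i ∈ s', g i = ∑ i ∈ s, g (e 0 i) + ∑ i ∈ s, g (e 1 i))
    (hab : ∀ i ∈ s, (a i, b i) ∈ A)
    (hstep : ∀ t i, a' (e t i) = ta t (a i, b i) (u i) (v i) ∧
      b' (e t i) = tb t (a i, b i) (u i) (v i) ∧
      u' (e t i) = tu t (a i, b i) (u i) (v i) ∧ v' (e t i) = tv t (a i, b i) (u i) (v i) ∧
      sgn' (e t i) = st t (a i, b i) (u i) (v i) * sgn i)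
    (x' : α × β) (y' : γ) (z' : δ) :
    ∑ i ∈ s'.filter (fun i => a' i = x'.1 ∧ b' i = x'.2 ∧ u' i = y' ∧ v' i = z'), sgn' i =
    ∑ x ∈ A, ∑ y : γ, ∑ z : δ, ∑ t ∈ Finset.range 2,
      if ta t x y z = x'.1 ∧ tb t x y z = x'.2 ∧ tu t x y z = y' ∧ tv t x y z = z'
      then st t x y z * fibN x y z else 0 := by
  rw [Finset.sum_filter, hs',
    transfer_t s A a b u v sgn hab (e 0) a' b' u' v' sgn' (ta 0) (tb 0) (tu 0) (tv 0) (st 0) (hstep 0),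
    transfer_t s A a b u v sgn hab (e 1) a' b' u' v' sgn' (ta 1) (tb 1) (tu 1) (tv 1) (st 1) (hstep 1)]
  simp only [Finset.sum_range_succ, Finset.sum_range_zero, zero_add, Finset.sum_add_distrib, hfibN]

/-- Doubling the dyadic range: `T' = t·2^N + T`, `t ∈ {0,1}`, `T < 2^N`. -/
theorem sum_range_double (N : ℕ) (g : ℕ → ℝ) :
    ∑ i ∈ range (2 ^ (N + 1)), g i =
      ∑ i ∈ range (2 ^ N), g (0 * 2 ^ N + i) + ∑ i ∈ range (2 ^ N), g (1 * 2 ^ N + i) := by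
  rw [pow_succ, mul_two, Finset.sum_range_add]
  simp only [zero_mul, one_mul, zero_add]

/-- Carry update: `⌊r(t·2^N + T)/2^{N+1}⌋ = (r t + ⌊rT/2^N⌋)/2`. -/
theorem carry_succ (r N t T : ℕ) :
    r * (t * 2 ^ N + T) / 2 ^ (N + 1) = (r * t + r * T / 2 ^ N) / 2 := by
  have h : r * (t * 2 ^ N + T) = 2 ^ N * (r * t) + r * T := by ring
  rw [h, pow_succ, ← Nat.div_div_eq_div_mul, Nat.mul_add_div (by positivity)]

/-- The digits of `r(t·2^N + T)` below `N` are those of `rT`. -/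
theorem bit_low (r N t T i : ℕ) (hi : i < N) :
    (if Nat.testBit (r * (t * 2 ^ N + T)) i then (1 : ZMod 2) else 0) =
      if Nat.testBit (r * T) i then 1 else 0 := by
  rw [testBit_mul_block, if_pos hi]

/-- The digit of `r(t·2^N + T)` at position `N` is `(r t + ⌊rT/2^N⌋) mod 2`. -/
theorem bit_succ (r N t T : ℕ) :
    (if Nat.testBit (r * (t * 2 ^ N + T)) N then (1 : ZMod 2) else 0) =
      if (r * t + r * T / 2 ^ N) % 2 = 1 then 1 else 0 := by
  rw [testBit_mul_block, if_neg (lt_irrefl N), Nat.sub_self, Nat.testBit_zero]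
  simp only [decide_eq_true_eq]

/-- Pending-form update: `π_{N+1} j = π_N j + a_{Nj} y_N` for `j ≥ N+1` (abstract digits `y`, `y'`
agreeing below `N`, new digit `β` at `N`). -/
theorem pend_succ {R : Type*} [CommRing R] {n : ℕ} (N : ℕ) (C : ℕ → Fin n → R) (D : Fin n → R)
    (y y' : ℕ → R) (β : R) (hy : ∀ i, i < N → y' i = y i) (hβ : y' N = β)
    (hD : ∀ j, D j = C N j) :
    (fun j : Fin n => if N + 1 ≤ (j : ℕ) then ∑ i ∈ range (N + 1), C i j * y' i else 0) =
      fun j : Fin n => if N + 1 ≤ (j : ℕ) then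
        (if N ≤ (j : ℕ) then ∑ i ∈ range N, C i j * y i else 0) + D j * β else 0 := by
  funext j
  split_ifs with h1 h2
  · rw [Finset.sum_range_succ, hβ, hD]
    congr 1
    exact Finset.sum_congr rfl fun i hi => by rw [hy i (mem_range.mp hi)]
  · omega
  · rfl

/-- Phase update: `Φ_{N+1} = Φ_N + β (Σ_{i<N} a_{iN} yᵢ + ℓ_N)` (abstract digits as in `pend_succ`). -/
theorem phase_succ {R : Type*} [CommRing R] (N : ℕ) (Q : ℕ → ℕ → R) (L y y' : ℕ → R) (β : R)
    (hy : ∀ i, i < N → y' i = y i) (hβ : y' N = β) :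
    (∑ i ∈ range (N + 1), ∑ j ∈ range (N + 1), (if i < j then Q i j * y' i * y' j else 0)) +
        ∑ i ∈ range (N + 1), L i * y' i =
      ((∑ i ∈ range N, ∑ j ∈ range N, (if i < j then Q i j * y i * y j else 0)) +
        ∑ i ∈ range N, L i * y i) + β * ((∑ i ∈ range N, Q i N * y i) + L N) := by
  have mN : ∀ i ∈ range N, y' i = y i := fun i hi => hy i (mem_range.mp hi)
  rw [Finset.sum_range_succ
      (f := fun i => ∑ j ∈ range (N + 1), if i < j then Q i j * y' i * y' j else 0),
    Finset.sum_range_succ (f := fun i => L i * y' i)]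
  have e0 : ∑ j ∈ range (N + 1), (if N < j then Q N j * y' N * y' j else 0) = 0 :=
    Finset.sum_eq_zero fun j hj => if_neg (by have := mem_range.mp hj; omega)
  have e1 : ∑ i ∈ range N, ∑ j ∈ range (N + 1), (if i < j then Q i j * y' i * y' j else 0) =
      ∑ i ∈ range N, ∑ j ∈ range N, (if i < j then Q i j * y i * y j else 0) +
        β * ∑ i ∈ range N, Q i N * y i := by
    rw [Finset.mul_sum, ← Finset.sum_add_distrib]
    refine Finset.sum_congr rfl fun i hi => ?_
    rw [Finset.sum_range_succ, if_pos (mem_range.mp hi), mN i hi, hβ]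
    congr 1
    · exact Finset.sum_congr rfl fun j hj => by rw [mN j hj]
    · ring
  have e2 : ∑ i ∈ range N, L i * y' i = ∑ i ∈ range N, L i * y i :=
    Finset.sum_congr rfl fun i hi => by rw [mN i hi]
  rw [e0, e1, e2, hβ]
  ring


/-- Sign update: the phase at level `N+1` is the phase at level `N` plus `(new digit)·(pending value at
column `N` + linear coefficient)`, on both sides; signs are multiplicative. -/
theorem sign_succ {n : ℕ} (N : ℕ) (hN : N < n) (Q : ℕ → ℕ → ZMod 2) (L : ℕ → ZMod 2)
    (C : ℕ → Fin n → ZMod 2) (yp yp' yq yq' : ℕ → ZMod 2) (βp βq : ZMod 2)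
    (hQC : ∀ i, Q i N = C i ⟨N, hN⟩)
    (hyp : ∀ i, i < N → yp' i = yp i) (hβp : yp' N = βp)
    (hyq : ∀ i, i < N → yq' i = yq i) (hβq : yq' N = βq) :
    (if ((∑ i ∈ range (N + 1), ∑ j ∈ range (N + 1), (if i < j then Q i j * yp' i * yp' j else 0)) +
          ∑ i ∈ range (N + 1), L i * yp' i) +
        ((∑ i ∈ range (N + 1), ∑ j ∈ range (N + 1), (if i < j then Q i j * yq' i * yq' j else 0)) +
          ∑ i ∈ range (N + 1), L i * yq' i) = 1 then (-1 : ℝ) else 1) =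
    (if βp * ((if h : N < n then (if N ≤ ((⟨N, h⟩ : Fin n) : ℕ) then
            ∑ i ∈ range N, C i ⟨N, h⟩ * yp i else 0) else 0) + L N) +
        βq * ((if h : N < n then (if N ≤ ((⟨N, h⟩ : Fin n) : ℕ) then
            ∑ i ∈ range N, C i ⟨N, h⟩ * yq i else 0) else 0) + L N) = 1
      then (-1 : ℝ) else 1) *
    (if ((∑ i ∈ range N, ∑ j ∈ range N, (if i < j then Q i j * yp i * yp j else 0)) +
          ∑ i ∈ range N, L i * yp i) +
        ((∑ i ∈ range N, ∑ j ∈ range N, (if i < j then Q i j * yq i * yq j else 0)) +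
          ∑ i ∈ range N, L i * yq i) = 1 then (-1 : ℝ) else 1) := by
  have e : ∀ y : ℕ → ZMod 2, (if h : N < n then (if N ≤ ((⟨N, h⟩ : Fin n) : ℕ) then
      ∑ i ∈ range N, C i ⟨N, h⟩ * y i else 0) else 0) = ∑ i ∈ range N, Q i N * y i := by
    intro y
    rw [dif_pos hN, if_pos (show N ≤ ((⟨N, hN⟩ : Fin n) : ℕ) from le_rfl)]
    exact Finset.sum_congr rfl fun i _ => by rw [hQC]
  rw [e, e, phase_succ N Q L yp yp' βp hyp hβp, phase_succ N Q L yq yq' βq hyq hβq, add_add_add_comm,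
    sign_add]
  exact mul_comm _ _

/-- The two spellings of the coefficient `a_{iN}` agree. -/
theorem coeff_QC {n : ℕ} (P : MvPolynomial (Fin n) (ZMod 2)) (N : ℕ) (hN : N < n) (i : ℕ) :
    (if h : i < n ∧ N < n then MvPolynomial.coeff (Finsupp.single (⟨i, h.1⟩ : Fin n) 1 +
        Finsupp.single (⟨N, h.2⟩ : Fin n) 1) P else 0) =
    (if h : i < n then MvPolynomial.coeff (Finsupp.single (⟨i, h⟩ : Fin n) 1 +
        Finsupp.single (⟨N, hN⟩ : Fin n) 1) P else 0) := by
  by_cases hi : i < n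
  · rw [dif_pos ⟨hi, hN⟩, dif_pos hi]
  · rw [dif_neg (fun h => hi h.1), dif_neg hi]

/-- The two spellings of the coefficient `a_{Nj}` agree. -/
theorem coeff_DC {n : ℕ} (P : MvPolynomial (Fin n) (ZMod 2)) (N : ℕ) (hN : N < n) (j : Fin n) :
    (if h : N < n ∧ (j : ℕ) < n then MvPolynomial.coeff (Finsupp.single (⟨N, h.1⟩ : Fin n) 1 +
        Finsupp.single (⟨(j : ℕ), h.2⟩ : Fin n) 1) P else 0) =
    (if h : N < n then MvPolynomial.coeff (Finsupp.single (⟨N, h⟩ : Fin n) 1 +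
        Finsupp.single j 1) P else 0) := by
  rw [dif_pos ⟨hN, j.is_lt⟩, dif_pos hN]

/-- OPERATOR SEMANTICS (registered stub `stub_opSem` of crux stmt-QuantumAdvantage-1391, line Sketch, skeleton v24): the fibre sums of the signed reduced-state measure start at the point mass and satisfy the one-step transfer recursion. -/
theorem stub_opSem :
    ∀ (p q n : ℕ) (P : MvPolynomial (Fin n) (ZMod 2)) (fib : ℕ → ℕ × ℕ → (Fin n → ZMod 2) → (Fin n → ZMod 2) → ℝ),
      (∀ (M : ℕ) (x : ℕ × ℕ) (π π' : Fin n → ZMod 2), fib M x π π' = (∑ T ∈ (Finset.range (2 ^ M)).filter (fun T => (p * T / 2 ^ M = x.1 ∧ q * T / 2 ^ M = x.2 ∧ (fun j : Fin n => if M ≤ (j : ℕ) then ∑ i ∈ Finset.range M, (if h : i < n then MvPolynomial.coeff (Finsupp.single (⟨i, h⟩ : Fin n) 1 + Finsupp.single j 1) P else 0) * (if Nat.testBit (p * T) i then (1 : ZMod 2) else 0) else 0) = π ∧ (fun j : Fin n => if M ≤ (j : ℕ) then ∑ i ∈ Finset.range M, (if h : i < n then MvPolynomial.coeff (Finsupp.single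 (⟨i, h⟩ : Fin n) 1 + Finsupp.single j 1) P else 0) * (if Nat.testBit (q * T) i then (1 : ZMod 2) else 0) else 0) = π')), (if (((∑ i ∈ Finset.range M, ∑ j ∈ Finset.range M, (if i < j then (if h : i < n ∧ j < n then MvPolynomial.coeff (Finsupp.single (⟨i, h.1⟩ : Fin n) 1 + Finsupp.single (⟨j, h.2⟩ : Fin n) 1) P else 0) * (if Nat.testBit (p * T) i then (1 : ZMod 2) else 0) * (if Nat.testBit (p * T) j then (1 : ZMod 2) else 0) else 0)) + ∑ i ∈ Finset.range M, (if h : i < n then MvPolynomial.coeff (Finsupp.single (⟨i, h⟩ : Fin n) 1) P + MvPolynomial.coeff (Finsupp.single (⟨i, h⟩ : Fin n) 2) P else 0) * (if Nat.testBit (p * T) i then (1 : ZMod 2) else 0)) + ((∑ i ∈ Finset.range M, ∑ j ∈ Finset.range M, (if i < j then (if h : i < n ∧ j < n then MvPolynomial.coeff (Finsupp.single (⟨i, h.1⟩ : Fin n) 1 + Finsupp.single (⟨j, h.2⟩ : Fin n) 1) P else 0) * (if Nat.testBit (q * T) i then (1 : ZMod 2) else 0) * (if Nat.testBit (q * T)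 j then (1 : ZMod 2) else 0) else 0)) + ∑ i ∈ Finset.range M, (if h : i < n then MvPolynomial.coeff (Finsupp.single (⟨i, h⟩ : Fin n) 1) P + MvPolynomial.coeff (Finsupp.single (⟨i, h⟩ : Fin n) 2) P else 0) * (if Nat.testBit (q * T) i then (1 : ZMod 2) else 0))) = 1 then (-1 : ℝ) else 1))) → 0 < p → 0 < q →
      (∀ (x : ℕ × ℕ) (π π' : Fin n → ZMod 2), fib 0 x π π' = if x = (0, 0) ∧ π = 0 ∧ π' = 0 then 1 else 0) ∧
      (∀ N', N' < n → ∀ (x' : ℕ × ℕ) (ρ ρ' : Fin n → ZMod 2), fib (N' + 1) x' ρ ρ' =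
          ∑ x ∈ Finset.range p ×ˢ Finset.range q, ∑ π : Fin n → ZMod 2, ∑ π' : Fin n → ZMod 2, ∑ t ∈ Finset.range 2,
            (if ((p * t + x.1) / 2 = x'.1 ∧ (q * t + x.2) / 2 = x'.2 ∧ (fun j : Fin n => if N' + 1 ≤ (j : ℕ) then π j + (if h : N' < n ∧ (j : ℕ) < n then MvPolynomial.coeff (Finsupp.single (⟨N', h.1⟩ : Fin n) 1 + Finsupp.single (⟨(j : ℕ), h.2⟩ : Fin n) 1) P else 0) * (if (p * t + x.1) % 2 = 1 then (1 : ZMod 2) else 0) else 0) = ρ ∧ (fun j : Fin n => if N' + 1 ≤ (j : ℕ) then π' j + (if h : N' < n ∧ (j : ℕ) < n then MvPolynomial.coeff (Finsupp.single (⟨N', h.1⟩ : Fin n) 1 + Finsupp.single (⟨(j : ℕ), h.2⟩ : Fin n) 1) P else 0) * (if (q * t + x.2) % 2 = 1 then (1 : ZMod 2) else 0) else 0) = ρ') then (if (if (p * t + x.1) % 2 = 1 then (1 : ZMod 2) else 0) * ((if h : N' < n then π ⟨N', h⟩ else 0) + (if h : N' < n then MvPolynomial.coeff (Finsupp.single (⟨N',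 h⟩ : Fin n) 1) P + MvPolynomial.coeff (Finsupp.single (⟨N', h⟩ : Fin n) 2) P else 0)) + (if (q * t + x.2) % 2 = 1 then (1 : ZMod 2) else 0) * ((if h : N' < n then π' ⟨N', h⟩ else 0) + (if h : N' < n then MvPolynomial.coeff (Finsupp.single (⟨N', h⟩ : Fin n) 1) P + MvPolynomial.coeff (Finsupp.single (⟨N', h⟩ : Fin n) 2) P else 0)) = 1 then (-1 : ℝ) else 1) * fib N' x π π' else 0)) := by
  intro p q n P fib hfib hp hq
  refine ⟨fun x π π' => ?_, fun N' hN' x' ρ ρ' => ?_⟩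
  · rw [hfib]
    simp only [pow_zero, Finset.range_one, Finset.sum_range_zero, add_zero, Nat.div_one, zero_le,
      if_true]
    rw [Finset.sum_filter, Finset.sum_singleton, mul_zero, mul_zero,
      if_neg (show ¬ ((0 : ZMod 2) = 1) by decide)]
    by_cases h : x = (0, 0) ∧ π = 0 ∧ π' = 0
    · rw [if_pos h, if_pos]
      obtain ⟨rfl, rfl, rfl⟩ := h
      exact ⟨rfl, rfl, rfl, rfl⟩
    · rw [if_neg h, if_neg]
      rintro ⟨h1, h2, h3, h4⟩
      exact h ⟨Prod.ext h1.symm h2.symm, h3.symm, h4.symm⟩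
  · rw [hfib]
    refine transfer (range (2 ^ (N' + 1))) (range (2 ^ N')) (range p ×ˢ range q)
      (fun t T => t * 2 ^ N' + T) (hfib N') (sum_range_double N') ?_ ?_ x' ρ ρ'
    · intro T hT
      rw [Finset.mem_range] at hT
      refine Finset.mem_product.mpr ⟨Finset.mem_range.mpr ?_, Finset.mem_range.mpr ?_⟩
      · exact Nat.div_lt_of_lt_mul (by
          calc p * T < p * 2 ^ N' := mul_lt_mul_of_pos_left hT hp
            _ = 2 ^ N' * p := Nat.mul_comm _ _)
      · exact Nat.div_lt_of_lt_mul (by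
          calc q * T < q * 2 ^ N' := mul_lt_mul_of_pos_left hT hq
            _ = 2 ^ N' * q := Nat.mul_comm _ _)
    · intro t T
      refine ⟨carry_succ p N' t T, carry_succ q N' t T, ?_, ?_, ?_⟩
      · exact pend_succ N' _ _ _ _ _ (fun i hi => bit_low p N' t T i hi) (bit_succ p N' t T)
          (fun j => coeff_DC P N' hN' j)
      · exact pend_succ N' _ _ _ _ _ (fun i hi => bit_low q N' t T i hi) (bit_succ q N' t T)
          (fun j => coeff_DC P N' hN' j)
      · exact sign_succ N' hN' _ _
          (fun i (j : Fin n) => if h : i < n then MvPolynomial.coeff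
            (Finsupp.single (⟨i, h⟩ : Fin n) 1 + Finsupp.single j 1) P else 0)
          _ _ _ _ _ _ (fun i => coeff_QC P N' hN' i)
          (fun i hi => bit_low p N' t T i hi) (bit_succ p N' t T)
          (fun i hi => bit_low q N' t T i hi) (bit_succ q N' t T)

end Summit.QuantumAdvantage.QuantumAdvantage.Theorems.MobiusLadderQuadraticDigitPhasesStubOpSem
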